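import Literature.Topology.FourManifolds.MMSWRasmussenFacts
import Literature.Topology.FourManifolds.MMSWModelBoundaryRegular
import Literature.Topology.FourManifolds.ImmersionCriterion
import Literature.Topology.FourManifolds.GluckTwistProofs
import Mathlib.Analysis.SpecialFunctions.Trigonometric.ArctanDeriv
import Summits.SmoothPoincare4.SmoothPoincare4.Theorems.DottedCircleRasmussenDcrGapStubFriendsH2HF3

/-!
# Helper `helper_friendsCarrier_Tk_tubeChart` of stub `helper_friendsCarrier_Tk` (line `mk_friends`, crux `DcrGap`)
(item stmt-SmoothPoincare4-16128, route route-SmoothPoincare4-DottedCircleRasmussen)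

**Tube coordinates on the flowed-out tube of a knot in the model boundary.**  Piece (2) of the
relative open trace `T_k` of the model dotted handlebody (`helper_friendsCarrier_Tk`).  Let `θ` be
the unit-speed collar flow of `M_k = ∂D_k ⊂ ℝ⁴` (piece (1), `helper_friendsCarrier_Tk_collarFlow`:
`G_k(θ(t, y)) = G_k y + t` on the band `B = {|z - c_j|² > 1/2, 1 - δ < G_k < 1 + δ}`), and let
`ν : 𝕊¹ × ℝ² → ℝ⁴` be a `C^∞` injective immersion with values in `M_k` (a tube around the model knot
`K₀ = ν(·, 0)`, as produced by the picture re-presentation `P_k`).  Then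

* the **flowed-out tube** `R = {y ∈ B | drop y ∈ ν(𝕊¹ × ℝ²)}` (`drop y = θ(1 - G_k y, y) ∈ M_k`) is
  OPEN in `ℝ⁴`, and
* there is a map `ι : ℝ⁴ → 𝕊¹ × ℝ²`, `C^∞` on `R`, with `ι (θ(s, ν q)) = q` (`|s| < δ`) and
  `θ(G_k y - 1, ν (ι y)) = y` on `R` — the tube coordinates of the `k = 0` template
  (`TubeNbhd.toHomeo.symm`, `contMDiffOn_toHomeo_symm` of `OpenTrace.lean`) one dimension up.

Proof: `Λ(q, σ) = θ(δ (2/π) arctan σ, ν q)` is a `C^∞` map `(𝕊¹ × ℝ²) × ℝ → ℝ⁴` between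
`4`-manifolds; it is injective (the clock reads off `σ`, and `θ(s, ·)` is invertible) and has
injective differential (a tangent vector killed by `dΛ` has no `σ`-component by the clock
`G_k ∘ Λ = 1 + δ (2/π) arctan σ`, and then lies in the kernel of `d(θ_s ∘ ν) = dθ_s ∘ dν`, both
injective), hence is an immersion (the tree's immersion criterion
`isImmersion_of_injective_mfderiv`, Lee Thm. 4.12) and an open map (invariance of domain for
immersions of equal dimension, `Manifold.IsImmersion.isOpenMap_of_finrank_eq`), i.e. an open
embedding with `C^∞` inverse on its range `R` (`contMDiffOn_leftInverse_of_isImmersion`,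
Lee Prop. 5.2); `ι` is the first component of the inverse.

Everything is proved; no definitions, no named facts, no `sorry`.

## References

* J. M. Lee, *Introduction to Smooth Manifolds*, 2nd ed. (2012), Thm. 4.12, Thm. 4.5, Prop. 5.2.
  [LeeSmoothManifolds2013]
* J. Milnor, *Lectures on the h-cobordism theorem* (1965), Thm. 3.4 (product neighbourhood of a
  regular level). [MilnorHCobordism1965]
-/

-- the prescribed namespace `Summit.<P>.<Sub>.…` duplicates `SmoothPoincare4` (P = Sub)
set_option linter.dupNamespace false
set_option linter.style.longLine false

noncomputable section

open scoped Manifold ContDiff Topology Real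
open Function Set Metric
open Literature.Topology.FourManifolds Literature.Topology.FourManifolds.MMSW

namespace Summit.SmoothPoincare4.SmoothPoincare4.Theorems.DcrGap.MkFriends

namespace FriendsTk

/-! ## The time reparametrisation `σ ↦ δ (2/π) arctan σ : ℝ ≅ (-δ, δ)` -/

/-- `δ (2/π) arctan σ ∈ (-δ, δ)` for `δ > 0`. [folklore] -/
theorem sOf_mem_Ioo {δ : ℝ} (hδ : 0 < δ) (σ : ℝ) : δ * (2 / π) * Real.arctan σ ∈ Ioo (-δ) δ := by
  have h1 := Real.arctan_lt_pi_div_two σ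
  have h2 := Real.neg_pi_div_two_lt_arctan σ
  have hπ := Real.pi_pos
  have h3 : (2 / π) * Real.arctan σ < 1 := by
    rw [div_mul_eq_mul_div, div_lt_one hπ]; linarith
  have h4 : -1 < (2 / π) * Real.arctan σ := by
    rw [div_mul_eq_mul_div, lt_div_iff₀ hπ]; linarith
  constructor <;> nlinarith

/-- The reparametrisation hits every `s ∈ (-δ, δ)`: `δ (2/π) arctan (tan (π s / (2δ))) = s`.
[folklore] -/
theorem sOf_tan {δ : ℝ} (hδ : 0 < δ) {s : ℝ} (hs : s ∈ Ioo (-δ) δ) :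
    δ * (2 / π) * Real.arctan (Real.tan (π * s / (2 * δ))) = s := by
  have hπ := Real.pi_pos
  have h1 : -(π / 2) < π * s / (2 * δ) := by
    rw [lt_div_iff₀ (by positivity)]; nlinarith [hs.1]
  have h2 : π * s / (2 * δ) < π / 2 := by
    rw [div_lt_iff₀ (by positivity)]; nlinarith [hs.2]
  rw [Real.arctan_tan h1 h2]
  field_simp

/-- The reparametrisation is smooth. [folklore] -/
theorem contDiff_sOf (δ : ℝ) : ContDiff ℝ ∞ (fun σ : ℝ => δ * (2 / π) * Real.arctan σ) :=
  contDiff_const.mul Real.contDiff_arctan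

/-- The reparametrisation has nonvanishing derivative `δ (2/π) / (1 + σ²)`. [folklore] -/
theorem hasDerivAt_sOf (δ σ : ℝ) :
    HasDerivAt (fun σ : ℝ => δ * (2 / π) * Real.arctan σ) (δ * (2 / π) * (1 / (1 + σ ^ 2))) σ :=
  (Real.hasDerivAt_arctan σ).const_mul _

/-- The reparametrisation is injective (`δ ≠ 0`). [folklore] -/
theorem sOf_injective {δ : ℝ} (hδ : 0 < δ) : Injective (fun σ : ℝ => δ * (2 / π) * Real.arctan σ) := by
  intro a b h
  have hc : δ * (2 / π) ≠ 0 := by positivity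
  exact Real.arctan_injective (mul_left_cancel₀ hc h)

/-! ## The flow-out of the tube is an open embedding -/

section TubeChart

variable {k : ℕ} {νK : (sphere (0 : EuclideanSpace ℝ (Fin 2)) 1) × EuclideanSpace ℝ (Fin 2) → EuclideanSpace ℝ (Fin 4)}
  {θ : ℝ × EuclideanSpace ℝ (Fin 4) → EuclideanSpace ℝ (Fin 4)} {δ : ℝ}

/-- **The flow-out of a tube in `M_k` is an open embedding with smooth inverse** (Milnor 1965,
Thm. 3.4, for the sub-level `ν(𝕊¹ × ℝ²) ⊆ M_k`; Lee 2012, Thm. 4.5 / Prop. 5.2): with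
`Λ(q, σ) = θ(δ (2/π) arctan σ, ν q)`, the map `Λ : (𝕊¹ × ℝ²) × ℝ → ℝ⁴` is `C^∞`, injective, an
immersion and an open map; its range is the flowed-out tube
`R = {|z - c_j|² > 1/2, 1 - δ < G_k < 1 + δ, drop ∈ range ν}`, which is therefore open, and the
inverse is `C^∞` on `R`. [cite: LeeSmoothManifolds2013, Thm. 4.5 and Prop. 5.2] -/
theorem tubeChart_aux (hδ : 0 < δ) (hθ : ContDiff ℝ ∞ θ) (h0 : ∀ x, θ (0, x) = x)
    (hadd : ∀ t s x, θ (t, θ (s, x)) = θ (t + s, x))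
    (hclock : ∀ y : EuclideanSpace ℝ (Fin 4), (∀ j, (1 : ℝ) / 2 < holeTerm k j y) →
      levelFun k y ∈ Ioo (1 - δ) (1 + δ) → ∀ t : ℝ, levelFun k y + t ∈ Ioo (1 - δ) (1 + δ) →
        (∀ j, (1 : ℝ) / 2 < holeTerm k j (θ (t, y))) ∧ levelFun k (θ (t, y)) = levelFun k y + t)
    (hν : ContMDiff ((𝓡 1).prod 𝓘(ℝ, EuclideanSpace ℝ (Fin 2))) 𝓘(ℝ, EuclideanSpace ℝ (Fin 4)) ∞ νK)
    (hinj : Injective νK)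
    (himm : ∀ p, Injective (mfderiv ((𝓡 1).prod 𝓘(ℝ, EuclideanSpace ℝ (Fin 2))) 𝓘(ℝ, EuclideanSpace ℝ (Fin 4)) νK p))
    (hmem : ∀ p, νK p ∈ modelBoundary k) :
    IsOpen {y : EuclideanSpace ℝ (Fin 4) | (∀ j, (1 : ℝ) / 2 < holeTerm k j y) ∧
        levelFun k y ∈ Ioo (1 - δ) (1 + δ) ∧ θ (1 - levelFun k y, y) ∈ range νK} ∧
      ∃ ι : EuclideanSpace ℝ (Fin 4) → (sphere (0 : EuclideanSpace ℝ (Fin 2)) 1) × EuclideanSpace ℝ (Fin 2),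
        ContMDiffOn 𝓘(ℝ, EuclideanSpace ℝ (Fin 4)) ((𝓡 1).prod 𝓘(ℝ, EuclideanSpace ℝ (Fin 2))) ∞ ι
          {y : EuclideanSpace ℝ (Fin 4) | (∀ j, (1 : ℝ) / 2 < holeTerm k j y) ∧
            levelFun k y ∈ Ioo (1 - δ) (1 + δ) ∧ θ (1 - levelFun k y, y) ∈ range νK} ∧
        (∀ (q : (sphere (0 : EuclideanSpace ℝ (Fin 2)) 1) × EuclideanSpace ℝ (Fin 2)) (s : ℝ),
          s ∈ Ioo (-δ) δ → ι (θ (s, νK q)) = q) ∧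
        (∀ y ∈ {y : EuclideanSpace ℝ (Fin 4) | (∀ j, (1 : ℝ) / 2 < holeTerm k j y) ∧
            levelFun k y ∈ Ioo (1 - δ) (1 + δ) ∧ θ (1 - levelFun k y, y) ∈ range νK},
          θ (levelFun k y - 1, νK (ι y)) = y) := by
  -- notation
  set sOf : ℝ → ℝ := fun σ => δ * (2 / π) * Real.arctan σ with hsOf
  set Λ : ((sphere (0 : EuclideanSpace ℝ (Fin 2)) 1) × EuclideanSpace ℝ (Fin 2)) × ℝ → EuclideanSpace ℝ (Fin 4) :=
    fun p => θ (sOf p.2, νK p.1) with hΛ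
  set R : Set (EuclideanSpace ℝ (Fin 4)) := {y | (∀ j, (1 : ℝ) / 2 < holeTerm k j y) ∧
    levelFun k y ∈ Ioo (1 - δ) (1 + δ) ∧ θ (1 - levelFun k y, y) ∈ range νK} with hR
  have hn : (∞ : ℕ∞ω) ≠ 0 := by simp
  -- the tube lies in the band; the clock along `Λ`
  have hνB : ∀ q, (∀ j, (1 : ℝ) / 2 < holeTerm k j (νK q)) ∧ levelFun k (νK q) ∈ Ioo (1 - δ) (1 + δ) := by
    intro q
    refine ⟨fun j => lt_of_lt_of_le (by norm_num) ((hmem q).1 j), ?_⟩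
    rw [(hmem q).2]; exact ⟨by linarith, by linarith⟩
  have hclockν : ∀ q s, s ∈ Ioo (-δ) δ →
      (∀ j, (1 : ℝ) / 2 < holeTerm k j (θ (s, νK q))) ∧ levelFun k (θ (s, νK q)) = 1 + s := by
    intro q s hs
    have h := hclock (νK q) (hνB q).1 (hνB q).2 s (by rw [(hmem q).2]; exact ⟨by linarith [hs.1], by linarith [hs.2]⟩)
    rw [(hmem q).2] at h
    exact h
  have hGΛ : ∀ p, levelFun k (Λ p) = 1 + sOf p.2 := fun p =>
    (hclockν p.1 (sOf p.2) (sOf_mem_Ioo hδ p.2)).2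
  have hinv : ∀ s x, θ (-s, θ (s, x)) = x := fun s x => by rw [hadd, neg_add_cancel, h0]
  -- smoothness of `Λ`
  have hΛs : ContMDiff (((𝓡 1).prod 𝓘(ℝ, EuclideanSpace ℝ (Fin 2))).prod 𝓘(ℝ, ℝ)) 𝓘(ℝ, EuclideanSpace ℝ (Fin 4)) ∞ Λ := by
    have h1 : ContMDiff (((𝓡 1).prod 𝓘(ℝ, EuclideanSpace ℝ (Fin 2))).prod 𝓘(ℝ, ℝ)) 𝓘(ℝ, ℝ) ∞
        (fun p : ((sphere (0 : EuclideanSpace ℝ (Fin 2)) 1) × EuclideanSpace ℝ (Fin 2)) × ℝ => sOf p.2) :=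
      (contDiff_sOf δ).contMDiff.comp contMDiff_snd
    have h2 : ContMDiff (((𝓡 1).prod 𝓘(ℝ, EuclideanSpace ℝ (Fin 2))).prod 𝓘(ℝ, ℝ)) 𝓘(ℝ, EuclideanSpace ℝ (Fin 4)) ∞
        (fun p : ((sphere (0 : EuclideanSpace ℝ (Fin 2)) 1) × EuclideanSpace ℝ (Fin 2)) × ℝ => νK p.1) :=
      hν.comp contMDiff_fst
    exact hθ.contMDiff.comp (h1.prodMk_space h2)
  -- injectivity of `Λ`
  have hΛinj : Injective Λ := by
    rintro ⟨q, σ⟩ ⟨q', σ'⟩ h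
    have hσ : σ = σ' := by
      have h1 := hGΛ (q, σ)
      have h2 := hGΛ (q', σ')
      simp only at h1 h2
      have : Λ (q, σ) = Λ (q', σ') := h
      rw [this] at h1
      exact sOf_injective hδ (by linarith)
    subst hσ
    have h' : θ (sOf σ, νK q) = θ (sOf σ, νK q') := h
    have := congrArg (fun x => θ (-sOf σ, x)) h'
    simp only [hinv] at this
    rw [hinj this]
  -- the differential of `θ(s, ·)` is injective
  have hθs : ∀ s, ContDiff ℝ ∞ (fun x : EuclideanSpace ℝ (Fin 4) => θ (s, x)) := fun s =>
    hθ.comp (contDiff_const.prodMk contDiff_id)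
  have hdθinj : ∀ s x, Injective (fderiv ℝ (fun x : EuclideanSpace ℝ (Fin 4) => θ (s, x)) x) := by
    intro s x v w hvw
    have hd1 : DifferentiableAt ℝ (fun x : EuclideanSpace ℝ (Fin 4) => θ (s, x)) x :=
      (hθs s).differentiable (by simp) x
    have hd2 : DifferentiableAt ℝ (fun x : EuclideanSpace ℝ (Fin 4) => θ (-s, x)) (θ (s, x)) :=
      (hθs (-s)).differentiable (by simp) _
    have hcomp : fderiv ℝ ((fun x : EuclideanSpace ℝ (Fin 4) => θ (-s, x)) ∘ fun x => θ (s, x)) x =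
        (fderiv ℝ (fun x : EuclideanSpace ℝ (Fin 4) => θ (-s, x)) (θ (s, x))).comp
          (fderiv ℝ (fun x : EuclideanSpace ℝ (Fin 4) => θ (s, x)) x) := fderiv_comp x hd2 hd1
    have hid : ((fun x : EuclideanSpace ℝ (Fin 4) => θ (-s, x)) ∘ fun x => θ (s, x)) = id := by
      funext y; exact hinv s y
    rw [hid, fderiv_id] at hcomp
    have hv := congrArg (fun L : EuclideanSpace ℝ (Fin 4) →L[ℝ] EuclideanSpace ℝ (Fin 4) => L v) hcomp
    have hw := congrArg (fun L : EuclideanSpace ℝ (Fin 4) →L[ℝ] EuclideanSpace ℝ (Fin 4) => L w) hcomp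
    simp only [ContinuousLinearMap.coe_id', id_eq, ContinuousLinearMap.comp_apply] at hv hw
    calc v = _ := hv
      _ = _ := by rw [hvw]
      _ = w := hw.symm
  -- injectivity of the differential of `Λ`
  have hΛimm : ∀ p, Injective (mfderiv (((𝓡 1).prod 𝓘(ℝ, EuclideanSpace ℝ (Fin 2))).prod 𝓘(ℝ, ℝ))
      𝓘(ℝ, EuclideanSpace ℝ (Fin 4)) Λ p) := by
    rintro ⟨q, σ⟩
    set I₃ := (𝓡 1).prod 𝓘(ℝ, EuclideanSpace ℝ (Fin 2)) with hI₃
    have hΛd : MDifferentiableAt (I₃.prod 𝓘(ℝ, ℝ)) 𝓘(ℝ, EuclideanSpace ℝ (Fin 4)) Λ (q, σ) :=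
      hΛs.mdifferentiableAt hn
    set L := mfderiv (I₃.prod 𝓘(ℝ, ℝ)) 𝓘(ℝ, EuclideanSpace ℝ (Fin 4)) Λ (q, σ) with hL
    -- the two partial maps and their differentials
    have hd1 : MDifferentiableAt I₃ 𝓘(ℝ, EuclideanSpace ℝ (Fin 4))
        (fun z : (sphere (0 : EuclideanSpace ℝ (Fin 2)) 1) × EuclideanSpace ℝ (Fin 2) => Λ (z, σ)) q :=
      (hΛs.comp (contMDiff_id.prodMk contMDiff_const)).mdifferentiableAt hn
    have hd2 : MDifferentiableAt 𝓘(ℝ, ℝ) 𝓘(ℝ, EuclideanSpace ℝ (Fin 4)) (fun z : ℝ => Λ (q, z)) σ :=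
      (hΛs.comp (contMDiff_const.prodMk contMDiff_id)).mdifferentiableAt hn
    set A₁ := mfderiv I₃ 𝓘(ℝ, EuclideanSpace ℝ (Fin 4))
      (fun z : (sphere (0 : EuclideanSpace ℝ (Fin 2)) 1) × EuclideanSpace ℝ (Fin 2) => Λ (z, σ)) q with hA₁
    set A₂ := mfderiv 𝓘(ℝ, ℝ) 𝓘(ℝ, EuclideanSpace ℝ (Fin 4)) (fun z : ℝ => Λ (q, z)) σ with hA₂
    -- the differential of the level function at `Λ (q, σ)`
    have h4 : ∀ j, holeTerm k j (Λ (q, σ)) ≠ 0 := fun j =>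
      (lt_trans (by norm_num) ((hclockν q (sOf σ) (sOf_mem_Ioo hδ σ)).1 j)).ne'
    have hGd : MDifferentiableAt 𝓘(ℝ, EuclideanSpace ℝ (Fin 4)) 𝓘(ℝ, ℝ) (levelFun k) (Λ (q, σ)) :=
      ((contDiffAt_levelFun h4).contMDiffAt).mdifferentiableAt hn
    set dG := mfderiv 𝓘(ℝ, EuclideanSpace ℝ (Fin 4)) 𝓘(ℝ, ℝ) (levelFun k) (Λ (q, σ)) with hdG
    -- (1) `dG ∘ A₁ = 0`: the level function is constant on the slice `Λ (·, σ)`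
    have hc1 : HasMFDerivAt I₃ 𝓘(ℝ, ℝ)
        (levelFun k ∘ fun z : (sphere (0 : EuclideanSpace ℝ (Fin 2)) 1) × EuclideanSpace ℝ (Fin 2) => Λ (z, σ))
        q (dG.comp A₁) :=
      hGd.hasMFDerivAt.comp q hd1.hasMFDerivAt
    have hfun1 : (levelFun k ∘ fun z : (sphere (0 : EuclideanSpace ℝ (Fin 2)) 1) × EuclideanSpace ℝ (Fin 2) => Λ (z, σ)) =
        fun _ => 1 + sOf σ := by
      funext z; exact hGΛ (z, σ)
    rw [hfun1] at hc1
    have heq1 : dG.comp A₁ = 0 := hasMFDerivAt_unique hc1 (hasMFDerivAt_const _ _)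
    -- (2) `dG ∘ A₂ = (τ ↦ τ c)`, `c ≠ 0`: the clock along `Λ (q, ·)`
    set c : ℝ := δ * (2 / π) * (1 / (1 + σ ^ 2)) with hc
    have hcne : c ≠ 0 := by positivity
    have hc2 : HasMFDerivAt 𝓘(ℝ, ℝ) 𝓘(ℝ, ℝ) (levelFun k ∘ fun z : ℝ => Λ (q, z)) σ (dG.comp A₂) :=
      hGd.hasMFDerivAt.comp σ hd2.hasMFDerivAt
    have hfun2 : (levelFun k ∘ fun z : ℝ => Λ (q, z)) = fun z : ℝ => 1 + sOf z := by
      funext z; exact hGΛ (q, z)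
    rw [hfun2] at hc2
    have hg' : HasMFDerivAt 𝓘(ℝ, ℝ) 𝓘(ℝ, ℝ) (fun z : ℝ => 1 + sOf z) σ
        (ContinuousLinearMap.toSpanSingleton ℝ c) :=
      hasMFDerivAt_iff_hasFDerivAt.2 ((hasDerivAt_sOf δ σ).const_add 1).hasFDerivAt
    have heq2 : dG.comp A₂ = ContinuousLinearMap.toSpanSingleton ℝ c := hasMFDerivAt_unique hc2 hg'
    -- (3) `A₁ = dθ_s ∘ dν`
    have hfun3 : (fun z : (sphere (0 : EuclideanSpace ℝ (Fin 2)) 1) × EuclideanSpace ℝ (Fin 2) => Λ (z, σ)) =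
        (fun x : EuclideanSpace ℝ (Fin 4) => θ (sOf σ, x)) ∘ νK := rfl
    have hθd : MDifferentiableAt 𝓘(ℝ, EuclideanSpace ℝ (Fin 4)) 𝓘(ℝ, EuclideanSpace ℝ (Fin 4))
        (fun x : EuclideanSpace ℝ (Fin 4) => θ (sOf σ, x)) (νK q) :=
      ((hθs (sOf σ)).contMDiff.mdifferentiableAt hn)
    have heq3 : A₁ = (mfderiv 𝓘(ℝ, EuclideanSpace ℝ (Fin 4)) 𝓘(ℝ, EuclideanSpace ℝ (Fin 4))
        (fun x : EuclideanSpace ℝ (Fin 4) => θ (sOf σ, x)) (νK q)).comp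
        (mfderiv I₃ 𝓘(ℝ, EuclideanSpace ℝ (Fin 4)) νK q) := by
      rw [hA₁, hfun3, mfderiv_comp q hθd (hν.mdifferentiableAt hn)]
    -- injectivity
    intro v w hvw
    rw [← sub_eq_zero]
    set u : TangentSpace (I₃.prod 𝓘(ℝ, ℝ)) (q, σ) := v - w with hu
    have hz : L u = 0 := by rw [hu, map_sub, sub_eq_zero]; exact hvw
    have hdec : L u = A₁ u.1 + A₂ u.2 := mfderiv_prod_eq_add_apply hΛd
    have e1 : dG (A₁ u.1) = 0 := by
      have := DFunLike.congr_fun heq1 u.1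
      exact this
    have e2 : dG (A₂ u.2) = u.2 • c := by
      have := DFunLike.congr_fun heq2 u.2
      exact this
    have hsum : dG (L u) = dG (A₁ u.1) + dG (A₂ u.2) := by rw [hdec, map_add]
    rw [hz, map_zero, e1, e2, zero_add] at hsum
    have hu2 : u.2 = (0 : TangentSpace 𝓘(ℝ, ℝ) σ) := by
      have h' : (u.2 : ℝ) * c = 0 := by
        have : u.2 • c = 0 := hsum.symm
        exact this
      exact (mul_eq_zero.1 h').resolve_right hcne
    have hu1' : A₁ u.1 = 0 := by
      have : L u = A₁ u.1 := by rw [hdec, hu2, map_zero, add_zero]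
      rw [← this, hz]
    rw [heq3] at hu1'
    have h1 : mfderiv I₃ 𝓘(ℝ, EuclideanSpace ℝ (Fin 4)) νK q u.1 = 0 := by
      have hcomp : (mfderiv 𝓘(ℝ, EuclideanSpace ℝ (Fin 4)) 𝓘(ℝ, EuclideanSpace ℝ (Fin 4))
          (fun x : EuclideanSpace ℝ (Fin 4) => θ (sOf σ, x)) (νK q))
          (mfderiv I₃ 𝓘(ℝ, EuclideanSpace ℝ (Fin 4)) νK q u.1) = 0 := hu1'
      rw [mfderiv_eq_fderiv] at hcomp
      exact hdθinj (sOf σ) (νK q)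
        (hcomp.trans (map_zero (fderiv ℝ (fun x : EuclideanSpace ℝ (Fin 4) => θ (sOf σ, x)) (νK q))).symm)
    have hu1 : u.1 = (0 : TangentSpace I₃ q) := himm q (by rw [h1, map_zero])
    exact Prod.ext hu1 hu2
  -- `Λ` is an immersion, hence an open map, hence an open embedding
  have hΛI : Manifold.IsImmersion (((𝓡 1).prod 𝓘(ℝ, EuclideanSpace ℝ (Fin 2))).prod 𝓘(ℝ, ℝ))
      𝓘(ℝ, EuclideanSpace ℝ (Fin 4)) ∞ Λ :=
    isImmersion_of_injective_mfderiv hΛs (by simp) hΛimm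
  have hΛopen : IsOpenMap Λ :=
    Manifold.IsImmersion.isOpenMap_of_finrank_eq hΛI (by simp)
  have hΛemb : Topology.IsOpenEmbedding Λ :=
    Topology.IsOpenEmbedding.of_continuous_injective_isOpenMap hΛs.continuous hΛinj hΛopen
  -- the range of `Λ` is the flowed-out tube `R`
  have hrange : range Λ = R := by
    ext y
    constructor
    · rintro ⟨⟨q, σ⟩, rfl⟩
      have hs := sOf_mem_Ioo hδ σ
      refine ⟨(hclockν q _ hs).1, ?_, ?_⟩
      · have := (hclockν q _ hs).2
        show levelFun k (θ (sOf σ, νK q)) ∈ Ioo (1 - δ) (1 + δ)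
        rw [this]; exact ⟨by linarith [hs.1], by linarith [hs.2]⟩
      · have := (hclockν q _ hs).2
        show θ (1 - levelFun k (θ (sOf σ, νK q)), θ (sOf σ, νK q)) ∈ range νK
        rw [this, show 1 - (1 + sOf σ) = -sOf σ by ring, hinv]
        exact mem_range_self q
    · rintro ⟨-, hG, q, hq⟩
      have hs : levelFun k y - 1 ∈ Ioo (-δ) δ := ⟨by linarith [hG.1], by linarith [hG.2]⟩
      refine ⟨(q, Real.tan (π * (levelFun k y - 1) / (2 * δ))), ?_⟩
      show θ (sOf (Real.tan (π * (levelFun k y - 1) / (2 * δ))), νK q) = y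
      rw [show sOf (Real.tan (π * (levelFun k y - 1) / (2 * δ))) = levelFun k y - 1 from sOf_tan hδ hs, hq,
        hadd, show levelFun k y - 1 + (1 - levelFun k y) = 0 by ring, h0]
  -- the smooth inverse
  haveI : Nonempty (((sphere (0 : EuclideanSpace ℝ (Fin 2)) 1) × EuclideanSpace ℝ (Fin 2)) × ℝ) :=
    ⟨((⟨EuclideanSpace.single 0 1, by simp⟩, 0), 0)⟩
  set g := Function.invFun Λ with hg
  have hgl : LeftInverse g Λ := Function.leftInverse_invFun hΛinj
  have hgs : ContMDiffOn 𝓘(ℝ, EuclideanSpace ℝ (Fin 4)) (((𝓡 1).prod 𝓘(ℝ, EuclideanSpace ℝ (Fin 2))).prod 𝓘(ℝ, ℝ))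
      ∞ g (range Λ) :=
    contMDiffOn_leftInverse_of_isImmersion hΛI hΛemb.isEmbedding hgl
  refine ⟨hrange ▸ hΛopen.isOpen_range, fun y => (g y).1, ?_, fun q s hs => ?_, fun y hy => ?_⟩
  · rw [← hrange]
    exact contMDiff_fst.comp_contMDiffOn hgs
  · have h1 : θ (s, νK q) = Λ (q, Real.tan (π * s / (2 * δ))) := by
      show θ (s, νK q) = θ (sOf (Real.tan (π * s / (2 * δ))), νK q)
      rw [show sOf (Real.tan (π * s / (2 * δ))) = s from sOf_tan hδ hs]
    rw [h1]
    show (g (Λ (q, Real.tan (π * s / (2 * δ))))).1 = q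
    rw [hgl]
  · rw [← hrange] at hy
    obtain ⟨⟨q, σ⟩, rfl⟩ := hy
    show θ (levelFun k (Λ (q, σ)) - 1, νK (g (Λ (q, σ))).1) = Λ (q, σ)
    rw [hgl, hGΛ]
    show θ (1 + sOf σ - 1, νK q) = θ (sOf σ, νK q)
    rw [add_sub_cancel_left]

end TubeChart

end FriendsTk

/-- **Helper `helper_friendsCarrier_Tk_tubeChart`** (registered on the crux item; piece (2) of the
relative open trace `T_k` of stub `helper_friendsCarrier_Tk`): for the collar flow `θ` of piece (1)
(only its smoothness, group law and clock on the band are used) and a `C^∞` injective immersion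
`ν : 𝕊¹ × ℝ² → M_k`, the flowed-out tube `R = {guard > 1/2, 1 - δ < G_k < 1 + δ, drop ∈ range ν}` is
open in `ℝ⁴` and carries `C^∞` tube coordinates `ι : R → 𝕊¹ × ℝ²` with `ι(θ(s, ν q)) = q` and
`θ(G_k y - 1, ν(ι y)) = y` (Lee 2012, Thm. 4.5 / Prop. 5.2; Milnor 1965, Thm. 3.4).
[cite: LeeSmoothManifolds2013, Thm. 4.5 and Prop. 5.2] -/
theorem helper_friendsCarrier_Tk_tubeChart : ∀ (k : ℕ) (νK : (Metric.sphere (0 : EuclideanSpace ℝ (Fin 2)) 1) × EuclideanSpace ℝ (Fin 2) → EuclideanSpace ℝ (Fin 4)) (θ : ℝ × EuclideanSpace ℝ (Fin 4) → EuclideanSpace ℝ (Fin 4)) (δ : ℝ), 0 < δ → ContDiff ℝ ((⊤ : ℕ∞) : WithTop ℕ∞) θ → (∀ x, θ (0, x) = x) → (∀ t s x, θ (t, θ (s, x)) = θ (t + s, x)) → (∀ y : EuclideanSpace ℝ (Fin 4), (∀ j, (1 : ℝ) / 2 < Literature.Topology.FourManifolds.MMSW.holeTerm k j y) → Literature.Topology.FourManifolds.MMSW.levelFun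 k y ∈ Set.Ioo (1 - δ) (1 + δ) → ∀ t : ℝ, Literature.Topology.FourManifolds.MMSW.levelFun k y + t ∈ Set.Ioo (1 - δ) (1 + δ) → (∀ j, (1 : ℝ) / 2 < Literature.Topology.FourManifolds.MMSW.holeTerm k j (θ (t, y))) ∧ Literature.Topology.FourManifolds.MMSW.levelFun k (θ (t, y)) = Literature.Topology.FourManifolds.MMSW.levelFun k y + t) → ContMDiff ((modelWithCornersSelf ℝ (EuclideanSpace ℝ (Fin 1))).prod (modelWithCornersSelf ℝ (EuclideanSpace ℝ (Fin 2)))) (modelWithCornersSelf ℝ (EuclideanSpace ℝ (Fin 4))) ((⊤ : ℕ∞) : WithTop ℕ∞) νK → Function.Injective νK → (∀ p, Function.Injective (mfderiv ((modelWithCornersSelf ℝ (EuclideanSpace ℝ (Fin 1))).prod (modelWithCornersSelf ℝ (EuclideanSpace ℝ (Fin 2)))) (modelWithCornersSelf ℝ (EuclideanSpace ℝ (Fin 4))) νK p)) → (∀ p, νK p ∈ Literature.Topology.FourManifolds.MMSW.modelBoundary k) → IsOpen {y : EuclideanSpace ℝ (Fin 4) | (∀ j, (1 : ℝ) / 2 <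 Literature.Topology.FourManifolds.MMSW.holeTerm k j y) ∧ Literature.Topology.FourManifolds.MMSW.levelFun k y ∈ Set.Ioo (1 - δ) (1 + δ) ∧ θ (1 - Literature.Topology.FourManifolds.MMSW.levelFun k y, y) ∈ Set.range νK} ∧ ∃ ι : EuclideanSpace ℝ (Fin 4) → (Metric.sphere (0 : EuclideanSpace ℝ (Fin 2)) 1) × EuclideanSpace ℝ (Fin 2), ContMDiffOn (modelWithCornersSelf ℝ (EuclideanSpace ℝ (Fin 4))) ((modelWithCornersSelf ℝ (EuclideanSpace ℝ (Fin 1))).prod (modelWithCornersSelf ℝ (EuclideanSpace ℝ (Fin 2)))) ((⊤ : ℕ∞) : WithTop ℕ∞) ι {y : EuclideanSpace ℝ (Fin 4) | (∀ j, (1 : ℝ) / 2 < Literature.Topology.FourManifolds.MMSW.holeTerm k j y) ∧ Literature.Topology.FourManifolds.MMSW.levelFun k y ∈ Set.Ioo (1 - δ) (1 + δ) ∧ θ (1 - Literature.Topology.FourManifolds.MMSW.levelFun k y, y) ∈ Set.range νK} ∧ (∀ (q : (Metric.sphere (0 : EuclideanSpace ℝ (Fin 2)) 1) × EuclideanSpace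 ℝ (Fin 2)) (s : ℝ), s ∈ Set.Ioo (-δ) δ → ι (θ (s, νK q)) = q) ∧ (∀ y ∈ {y : EuclideanSpace ℝ (Fin 4) | (∀ j, (1 : ℝ) / 2 < Literature.Topology.FourManifolds.MMSW.holeTerm k j y) ∧ Literature.Topology.FourManifolds.MMSW.levelFun k y ∈ Set.Ioo (1 - δ) (1 + δ) ∧ θ (1 - Literature.Topology.FourManifolds.MMSW.levelFun k y, y) ∈ Set.range νK}, θ (Literature.Topology.FourManifolds.MMSW.levelFun k y - 1, νK (ι y)) = y) :=
  fun _ _ _ _ hδ hθ h0 hadd hclock hν hinj himm hmem =>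
    FriendsTk.tubeChart_aux hδ hθ h0 hadd hclock hν hinj himm hmem

end Summit.SmoothPoincare4.SmoothPoincare4.Theorems.DcrGap.MkFriends

end
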